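import Mathlib
import Summits.Ventures.HodgeRepro2.T5WedgeDet
import Summits.Ventures.HodgeRepro2.T5TopFormCharacter
import Summits.Ventures.HodgeRepro2.T5HodgeTypeCovectors

/-!
# T5HodgeTypePullBack — pull-back of covectors along a map of split spaces preserves the
`(p,q)`-types (N1 Theorem ID(i): «`f_i^*` is a morphism of Hodge structures»)

Sub-step N1 of Tier 5 (route/T5-ID-p2.md, §ID-1) sorts the vertex classes `f_i^* e_{i,τ₁}` by
Hodge type using that each `f_i^*` is a morphism of Hodge structures (Tier-4 B7(b) HODGE
TYPES): a `(1,0)`-class pulls back to a `(1,0)`-class, and the wedge `ω_{ab} = f_a^* e_a ∧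
f_b^* e_b` is of type `(2,0)`.  This file records that step at the covector level, on top of
`T5HodgeTypeCovectors` (the `(p,q)`-sorting under an idempotent splitting `p`, `q = 1 − p`).

A linear map `φ : V′ → V` between split spaces is *compatible* with the splittings `p′`, `p`
when `φ ∘ p′ = p ∘ φ` (`IsSplitMap`; it maps `𝔭′⁺` into `𝔭⁺` and `𝔭′⁻` into `𝔭⁻`).  Then:

* `IsType10.comp`, `IsType01.comp` — pull-back preserves the types of 1-covectors;
* `type20_compLinearMap`, `type02_compLinearMap`, `type11_compLinearMap` — pull-back commutes
  with the three `(p,q)`-components of a 2-covector;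
* `IsType20.compLinearMap`, `IsType02.compLinearMap`, `IsType11.compLinearMap` — pull-back
  preserves the types of 2-covectors;
* `wedge_comp_isType20` — `f_a^* e_a ∧ f_b^* e_b` is of type `(2,0)` for compatible `f_a, f_b`
  and `(1,0)`-covectors `e_a, e_b`;
* `IsSplitMap.comp`, `IsSplitMap.id` — compatible maps compose.

Nothing about varieties, Hodge structures or cohomology is formalised: `V`, `V′` are vector
spaces over a field `K` with idempotent splittings.
-/

namespace Summit.Ventures.HodgeRepro2.T5HodgeTypePullBack

open Summit.Ventures.HodgeRepro2.T5WedgeDet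
open Summit.Ventures.HodgeRepro2.T5HodgeTypeCovectors

variable {K : Type*} [Field K] {V : Type*} [AddCommGroup V] [Module K V]

/-! ## §1 Compatible maps and pull-back -/

section PullBack

variable {V' : Type*} [AddCommGroup V'] [Module K V']

/-- A linear map of split spaces is compatible with the splittings when `φ ∘ p′ = p ∘ φ`. -/
def IsSplitMap (p : V →ₗ[K] V) (p' : V' →ₗ[K] V') (φ : V' →ₗ[K] V) : Prop :=
  φ ∘ₗ p' = p ∘ₗ φ

/-- A compatible map also intertwines the complementary projections. -/
theorem IsSplitMap.comp_q (p : V →ₗ[K] V) (p' : V' →ₗ[K] V') {φ : V' →ₗ[K] V}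
    (h : IsSplitMap p p' φ) : φ ∘ₗ q p' = q p ∘ₗ φ := by
  unfold q
  rw [LinearMap.comp_sub, LinearMap.sub_comp, LinearMap.comp_id, LinearMap.id_comp, h]

/-- Pull-back preserves type `(1,0)`. -/
theorem IsType10.comp (p : V →ₗ[K] V) (p' : V' →ₗ[K] V') {φ : V' →ₗ[K] V}
    (h : IsSplitMap p p' φ) {f : V →ₗ[K] K} (hf : IsType10 p f) : IsType10 p' (f ∘ₗ φ) := by
  unfold IsType10 at hf ⊢
  rw [LinearMap.comp_assoc, h, ← LinearMap.comp_assoc, hf]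

/-- Pull-back preserves type `(0,1)`. -/
theorem IsType01.comp (p : V →ₗ[K] V) (p' : V' →ₗ[K] V') {φ : V' →ₗ[K] V}
    (h : IsSplitMap p p' φ) {f : V →ₗ[K] K} (hf : IsType01 p f) : IsType01 p' (f ∘ₗ φ) := by
  unfold IsType01 at hf ⊢
  rw [LinearMap.comp_assoc, h.comp_q, ← LinearMap.comp_assoc, hf]

/-- Pull-back commutes with the `(2,0)`-component. -/
theorem type20_compLinearMap (p : V →ₗ[K] V) (p' : V' →ₗ[K] V') {φ : V' →ₗ[K] V}
    (h : IsSplitMap p p' φ) (ω : V [⋀^Fin 2]→ₗ[K] K) :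
    type20 p' (ω.compLinearMap φ) = (type20 p ω).compLinearMap φ := by
  unfold type20
  rw [AlternatingMap.compLinearMap_assoc, AlternatingMap.compLinearMap_assoc, h]

/-- Pull-back commutes with the `(0,2)`-component. -/
theorem type02_compLinearMap (p : V →ₗ[K] V) (p' : V' →ₗ[K] V') {φ : V' →ₗ[K] V}
    (h : IsSplitMap p p' φ) (ω : V [⋀^Fin 2]→ₗ[K] K) :
    type02 p' (ω.compLinearMap φ) = (type02 p ω).compLinearMap φ := by
  unfold type02
  rw [AlternatingMap.compLinearMap_assoc, AlternatingMap.compLinearMap_assoc, h.comp_q]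

/-- `compLinearMap` is additive in the alternating map, subtraction version, for a map between
two spaces. -/
theorem sub_compLinearMap' (ω ω' : V [⋀^Fin 2]→ₗ[K] K) (φ : V' →ₗ[K] V) :
    (ω - ω').compLinearMap φ = ω.compLinearMap φ - ω'.compLinearMap φ := by
  ext v
  simp only [AlternatingMap.compLinearMap_apply, AlternatingMap.sub_apply]

/-- Pull-back commutes with the `(1,1)`-component. -/
theorem type11_compLinearMap (p : V →ₗ[K] V) (p' : V' →ₗ[K] V') {φ : V' →ₗ[K] V}
    (h : IsSplitMap p p' φ) (ω : V [⋀^Fin 2]→ₗ[K] K) :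
    type11 p' (ω.compLinearMap φ) = (type11 p ω).compLinearMap φ := by
  unfold type11
  rw [sub_compLinearMap', sub_compLinearMap', type20_compLinearMap p p' h,
    type02_compLinearMap p p' h]

/-- Pull-back preserves type `(2,0)`. -/
theorem IsType20.compLinearMap (p : V →ₗ[K] V) (p' : V' →ₗ[K] V') {φ : V' →ₗ[K] V}
    (h : IsSplitMap p p' φ) {ω : V [⋀^Fin 2]→ₗ[K] K} (hω : IsType20 p ω) :
    IsType20 p' (ω.compLinearMap φ) := by
  unfold IsType20 at hω ⊢
  have := type20_compLinearMap p p' h ω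
  unfold type20 at this
  rw [this, hω]

/-- Pull-back preserves type `(0,2)`. -/
theorem IsType02.compLinearMap (p : V →ₗ[K] V) (p' : V' →ₗ[K] V') {φ : V' →ₗ[K] V}
    (h : IsSplitMap p p' φ) {ω : V [⋀^Fin 2]→ₗ[K] K} (hω : IsType02 p ω) :
    IsType02 p' (ω.compLinearMap φ) := by
  unfold IsType02 at hω ⊢
  have := type02_compLinearMap p p' h ω
  unfold type02 at this
  rw [this, hω]

/-- Pull-back preserves type `(1,1)`. -/
theorem IsType11.compLinearMap (p : V →ₗ[K] V) (p' : V' →ₗ[K] V') {φ : V' →ₗ[K] V}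
    (h : IsSplitMap p p' φ) {ω : V [⋀^Fin 2]→ₗ[K] K} (hω : IsType11 p ω) :
    IsType11 p' (ω.compLinearMap φ) := by
  unfold IsType11 at hω ⊢
  have h1 := type20_compLinearMap p p' h ω
  have h2 := type02_compLinearMap p p' h ω
  unfold type20 at h1
  unfold type02 at h2
  simp only [h1, h2, hω.1, hω.2, AlternatingMap.zero_compLinearMap, and_self]

/-- The pull-back of the wedge of two `(1,0)`-covectors along a compatible map is the wedge of
two `(1,0)`-covectors, hence of type `(2,0)` — Theorem ID(i)'s `f_a^* e_a ∧ f_b^* e_b ∈ H^{2,0}`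
at the covector level. -/
theorem wedge_comp_isType20 (p : V →ₗ[K] V) (p' : V' →ₗ[K] V') {φ : V' →ₗ[K] V}
    (h : IsSplitMap p p' φ) {f g : V →ₗ[K] K} (hf : IsType10 p f) (hg : IsType10 p g) :
    IsType20 p' (wedge (f ∘ₗ φ) (g ∘ₗ φ)) :=
  wedge_isType20 p' (IsType10.comp p p' h hf) (IsType10.comp p p' h hg)

/-- Compatible maps compose. -/
theorem IsSplitMap.comp {V'' : Type*} [AddCommGroup V''] [Module K V''] (p : V →ₗ[K] V)
    (p' : V' →ₗ[K] V') (p'' : V'' →ₗ[K] V'') {φ : V' →ₗ[K] V} {ψ : V'' →ₗ[K] V'}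
    (hφ : IsSplitMap p p' φ) (hψ : IsSplitMap p' p'' ψ) : IsSplitMap p p'' (φ ∘ₗ ψ) := by
  unfold IsSplitMap at hφ hψ ⊢
  rw [LinearMap.comp_assoc, hψ, ← LinearMap.comp_assoc, hφ, LinearMap.comp_assoc]

/-- The identity is compatible. -/
theorem IsSplitMap.id (p : V →ₗ[K] V) : IsSplitMap p p LinearMap.id := by
  unfold IsSplitMap
  rw [LinearMap.id_comp, LinearMap.comp_id]

end PullBack

end Summit.Ventures.HodgeRepro2.T5HodgeTypePullBack
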